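import Summits.ValiantsHypothesis.ValiantsHypothesis.Theorems.DefinabilityGapClusterMerging
import Summits.ValiantsHypothesis.ValiantsHypothesis.Theorems.DefinabilityGapMatchingClusters
import Summits.ValiantsHypothesis.ValiantsHypothesis.Theorems.DefinabilityGapFourMatchings
import HarnessLib

/-!
# DefinabilityGap — MATCHING SUMS: the planted KI map hits every nonzero sum of ≤ k matching products, for every k

Route `route-ValiantsHypothesis-DefinabilityGap` (decomp-valiant, lens 5: hardness–randomness / PIT axis); width
road of the read-once leaf F4 / W10 (`KIPlantedHittingRO`, stmt-ValiantsHypothesis-23704, aside).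
ELEMENTARY · NEW-COMBINATION (y-side: the merge lever along a list + the PATCHED support rung of
`DefinabilityGapClusterMerging` = variant / instrument of own levers F-C / F-F; z-side: GAP SCALE clustering of
product gates + one vertex-disjoint kill edge per foreign gate, `DefinabilityGapMatchingClusters` = new on this
problem) · DECIDES the graphical-MATCHING ΣΠΣ(k) clause for ALL k · 0 S-currency · closes NO item · K1 /
stmt-23704 / VP ≠ VNP untouched.

## The theorem (★ `kiPer_hits_matchingSums`)

Blocks `B = Fin 3 → F_q`; an ORIENTED MATCHING is a finite edge set `M ⊆ B × B` with `toLex e.1 < toLex e.2` on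
every edge and distinct edges vertex-disjoint; `Δ_M = dprod M = ∏_{(u,v) ∈ M} (X_u − X_v)`. For every fan-in `k`,
every family `𝓜` of `≤ k` oriented matchings and all coefficients `α`: if `f = Σ_{M ∈ 𝓜} α_M Δ_M ≠ 0` and
`(2 + 2·3^k)·(2k²·(4k²)^{k²}) < m²`, then `φ(f) = bind₁ (kiPer m) f ≠ 0` — the planted Kabanets–Impagliazzo map
`G_m` hits `f` (`kiPer_hits_matchingSums`; `kiPer_hits_matchingSums_eqCard` is the equal-size case,
`kiPer_hits_matchingSums_eventually` the `∃ m₀ ∀ m ≥ m₀` form). This retires «single-term isolation» and its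
k = 6 ceiling (two far K₄-clusters): the isolated object is a CLUSTER of gates, not a gate.

## The six STEPS

STEP 0 (sizes): `φ(Δ_M)` is homogeneous of degree `m·|M|` (`isHomogeneous_kiPer_dprod`), so `φ f = 0` forces
`φ f_n = 0` for each size component `f_n` (`homogeneousComponent_bind₁_sum`); sizes may be assumed equal.
STEP 1 (GAP SCALE): the `≤ k²` distances `|M ∖ M′|` skip one of the `k² + 1` levels `(4k²)^t`: at `R = (4k²)^t`
every pair is near (`< R`) or far (`≥ 4k²·R`) (`exists_gap_level`).
STEP 2 (home cluster): near-ness is an equivalence (equal sizes: `Finset.card_sdiff_comm`; the gap gives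
transitivity), and some cluster `H ∋ M₀` has `f_H ≠ 0` (`exists_class_sum_ne_zero`).
STEP 3 (core): the common core `C` of `H` satisfies `f_H = Δ_C · h`, `h ≠ 0`, `vars h ⊆ T` with `|T| ≤ 2k²R`
(`C = M₀ ∖ ⋃_{M′∈H}(M₀ ∖ M′)`; `M ∖ C ⊆ ⋃_{M′∈H}(M ∖ M′)`, the count of `card_sdiff_core_le`; `vars_C_mul_dprod_subset`).
STEP 4 (kill edges): every foreign gate `M′ ∉ H` is far from `M₀`, hence has `≥ 4k²R > |T| + 2(k − 2)` edges
outside `M₀`; being a MATCHING it has one avoiding `T` and the previously chosen edges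
(`exists_disjoint_selection`): a list `L` of `≤ k − 1` pairwise vertex-disjoint kill edges.
STEP 5 (merge): the iterated patch family `W_L` (`wordL`) factors through `φ` by an algebra map
(`bind₁_wordL_eq_zero_of_kiPer`), kills every foreign gate (`bind₁_wordL_dprod_eq_zero`) and keeps `Δ_C` nonzero
(`bind₁_wordL_dprod_ne_zero`: core edges are loopless, miss every kill edge since kill edges avoid `M₀ ⊇ C`, and
miss their reverses by `not_mem_swap_of_oriented`); so `φ_L h = 0`.
STEP 6 (patched support rung): `T` consists of live blocks (kill endpoints avoid `T`), the patched cells form an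
NW design with intersections `≤ 2·3^{|L|}`, and `(2·3^{|L|})(|T| − 1) < m²`: `bind₁_wordL_ne_zero` gives
`φ_L h ≠ 0` — contradiction.

The threshold `Φ(k) = (2 + 2·3^k)·(2k²·(4k²)^{k²})` is doubly exponential in `k`; no optimisation is attempted.
`DefinabilityGapThreeMatchings` (★ at `m ≥ 6`) and `DefinabilityGapFourMatchings` (★ at `m ≥ 10`) remain the
sharp small-fan-in thresholds for k = 3, 4; they are neither re-proved nor deprecated here.

## WHY-RESIDUAL (K6 non-vacuity; the majority ideal)

The k = 6 family of two far K₄-clusters of `DefinabilityGapFourMatchings` (`M_{2s−1}, M_{2s}` differing only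
inside cluster `s`, no single-term isolation, unbounded exclusive support) and, for every fan-in `k ≥ 5`, every
family of `k` oriented matchings of common size `n ≥ ⌈m/2⌉` with `f ≠ 0` lie in the majority ideal
`I_{⌈m/2⌉−1}` BY NAME: `dprod_restrict_eq_zero` — each `Δ_M` restricted to `≤ n − 1` free blocks vanishes at
every base point — so they are invisible to every restriction road, the degree road, sparsity, ΣΠΣ(2), width 2,
and (for `k ≥ 5`) to the three- and four-matching theorems; ★ hits all of them once `Φ(k) < m²`.

## BY-NAME reuse

`isHomogeneous_kiPer_dprod`, `Finset.card_sdiff_comm`, `vars_C_mul_dprod_subset`, `loopless_of_oriented`,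
`not_mem_swap_of_oriented` (ThreeMatchings); through `DefinabilityGapClusterMerging`: `rename_mergeSub_bind₁`,
`kiPer_eq_wordPoly`, `patch_apply_self` / `patch_apply_left`, `card_differ_patch_le`, `wordPoly_ne_of_differ_le`,
`agree_subset`, `card_agree_kiWord_le`, `wordCell_injective`, `kiGenerator_apply`,
`exists_rename_eq_of_vars_subset_range`, `KIPrivate.bind₁_kiGenerator_perPoly_ne_zero`; through
`DefinabilityGapMatchingClusters`: `exists_gap_level`, `exists_class_sum_ne_zero`, `card_sdiff_le_add`,
`card_biUnion_sdiff_le`, `card_endpoints_le`, `exists_disjoint_selection` (the core count of `card_sdiff_core_le` is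
re-run here on the set-difference form of the core).

## HONEST BOUNDARY

HONEST BOUNDARY: 0 S-currency; closes NO item; the theorem decides the graphical-MATCHING ΣΠΣ(k) clause of the
depth-3 side for EVERY fan-in k once (2+2·3^k)·(2k²·(4k²)^{k²}) < m², and nothing else — general graphical
MULTISETS of edges (term-rank merging; the cubic identity x³+y³−(x+y)³ = −3xy(x+y)), non-graphical AFFINE forms,
the LEAF REGIME w = q^b ≫ m and fan-in k growing with m beyond that threshold are NOT claimed; K1 / stmt-23704 /
VP ≠ VNP untouched.
-/

noncomputable section

open MvPolynomial
open Literature.Computability.AlgebraicComplexity Literature.Computability.MetaComplexity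
open Summit.ValiantsHypothesis.ValiantsHypothesis.Theorems.DefinabilityGapAffineRung
open Summit.ValiantsHypothesis.ValiantsHypothesis.Theorems.DefinabilityGapSupportRung
open Summit.ValiantsHypothesis.ValiantsHypothesis.Theorems.DefinabilityGapBlockMerging
open Summit.ValiantsHypothesis.ValiantsHypothesis.Theorems.DefinabilityGapThreeMatchings
open Summit.ValiantsHypothesis.ValiantsHypothesis.Theorems.DefinabilityGapMergeIsolation
open Summit.ValiantsHypothesis.ValiantsHypothesis.Theorems.DefinabilityGapClusterMerging
open Summit.ValiantsHypothesis.ValiantsHypothesis.Theorems.DefinabilityGapMatchingClusters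

set_option linter.dupNamespace false

namespace Summit.ValiantsHypothesis.ValiantsHypothesis.Theorems.DefinabilityGapMatchingSums

variable {m : ℕ}

/-! ## 1. STEP 0: size classes -/

/-- SIZE FILTER: the degree-`n·m` component of `φ(Σ α_M Δ_M)` is `φ` of the size-`n` part. [this file] -/
theorem homogeneousComponent_bind₁_sum (hm0 : 0 < m)
    (𝓜 : Finset (Finset ((Fin 3 → Fin (qOf m)) × (Fin 3 → Fin (qOf m)))))
    (α : Finset ((Fin 3 → Fin (qOf m)) × (Fin 3 → Fin (qOf m))) → ℂ) (n : ℕ) :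
    homogeneousComponent (n * m) (bind₁ (kiPer m) (∑ M ∈ 𝓜, C (α M) * dprod M)) =
      bind₁ (kiPer m) (∑ M ∈ 𝓜 with M.card = n, C (α M) * dprod M) := by
  rw [map_sum (bind₁ (kiPer m)) _ 𝓜, map_sum (homogeneousComponent (n * m)), map_sum (bind₁ (kiPer m)),
    Finset.sum_filter]
  refine Finset.sum_congr rfl fun M _ => ?_
  rw [map_mul, bind₁_C_right, homogeneousComponent_C_mul,
    homogeneousComponent_of_mem (isHomogeneous_kiPer_dprod M)]
  by_cases h : M.card = n
  · rw [if_pos (show n * m = M.card * m by rw [h]), if_pos h]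
  · rw [if_neg (show ¬n * m = M.card * m from fun e => h (Nat.eq_of_mul_eq_mul_right hm0 e).symm),
      if_neg h, mul_zero]

/-! ## 2. STEPS 1–6: the equal-size case -/

/-- ★ (equal sizes) **CLUSTER ISOLATION**: for `≤ k` oriented matchings of one size, `f = Σ α_M Δ_M ≠ 0` and
`(2 + 2·3^k)(2k²(4k²)^{k²}) < m²` give `φ(f) ≠ 0`. [this file] -/
theorem kiPer_hits_matchingSums_eqCard {k n : ℕ}
    (hm : (2 + 2 * 3 ^ k) * (2 * k ^ 2 * (4 * k ^ 2) ^ (k ^ 2)) < m * m)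
    (𝓜 : Finset (Finset ((Fin 3 → Fin (qOf m)) × (Fin 3 → Fin (qOf m))))) (hk : 𝓜.card ≤ k)
    (hn : ∀ M ∈ 𝓜, M.card = n) (ho : ∀ M ∈ 𝓜, ∀ e ∈ M, toLex e.1 < toLex e.2)
    (hd : ∀ M ∈ 𝓜, ∀ e ∈ M, ∀ e' ∈ M, e ≠ e' → e.1 ≠ e'.1 ∧ e.1 ≠ e'.2 ∧ e.2 ≠ e'.1 ∧ e.2 ≠ e'.2)
    (α : Finset ((Fin 3 → Fin (qOf m)) × (Fin 3 → Fin (qOf m))) → ℂ) (hf : ∑ M ∈ 𝓜, C (α M) * dprod M ≠ 0) :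
    bind₁ (kiPer m) (∑ M ∈ 𝓜, C (α M) * dprod M) ≠ 0 := by
  intro h0
  -- numerics I
  have hk1 : 1 ≤ k := by
    by_contra hk0
    have h𝓜 : 𝓜 = ∅ := Finset.card_eq_zero.1 (by omega)
    exact hf (by rw [h𝓜, Finset.sum_empty])
  have hk0 : 0 < k := hk1
  have hkk : 0 < k ^ 2 := pow_pos hk0 2
  have hP1 : 0 < 2 * k ^ 2 * (4 * k ^ 2) ^ (k ^ 2) :=
    mul_pos (mul_pos (by norm_num) hkk) (pow_pos (mul_pos (by norm_num) hkk) _)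
  -- STEP 1: the gap scale
  obtain ⟨R, hR1, hRle, hgap⟩ := exists_gap_level 𝓜 hk (show 2 ≤ 4 * k ^ 2 by omega)
  have hR0 : 0 < R := hR1
  -- STEP 2: near-clusters and the home cluster
  have hrefl : ∀ M ∈ 𝓜, (M \ M).card < R := fun M _ => by
    rw [Finset.sdiff_self, Finset.card_empty]; exact hR0
  have hsymm : ∀ M ∈ 𝓜, ∀ M' ∈ 𝓜, (M \ M').card < R → (M' \ M).card < R := fun M hM M' hM' h => by
    rwa [Finset.card_sdiff_comm ((hn M' hM').trans (hn M hM).symm)]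
  have htrans : ∀ M ∈ 𝓜, ∀ M' ∈ 𝓜, ∀ M'' ∈ 𝓜, (M \ M').card < R → (M' \ M'').card < R →
      (M \ M'').card < R := fun M hM M' _ M'' hM'' h1 h2 => by
    rcases hgap M hM M'' hM'' with h | h
    · exact h
    · exfalso
      have h3 := card_sdiff_le_add M M' M''
      have h5 : 4 * R ≤ 4 * k ^ 2 * R := Nat.mul_le_mul_right _ (by omega)
      omega
  obtain ⟨M₀, hM₀, hfH⟩ := exists_class_sum_ne_zero 𝓜 (fun M M' => (M \ M').card < R) hrefl hsymm htrans
    (fun M => C (α M) * dprod M) hf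
  obtain ⟨H, hHdef⟩ : ∃ H : Finset (Finset ((Fin 3 → Fin (qOf m)) × (Fin 3 → Fin (qOf m)))),
      H = 𝓜.filter fun M => (M₀ \ M).card < R := ⟨_, rfl⟩
  have hfH' : ∑ M ∈ H, C (α M) * dprod M ≠ 0 := by rw [hHdef]; exact hfH
  have hHsub : H ⊆ 𝓜 := by rw [hHdef]; exact Finset.filter_subset _ _
  have hmemH : ∀ {M}, M ∈ H ↔ M ∈ 𝓜 ∧ (M₀ \ M).card < R := fun {M} => by rw [hHdef, Finset.mem_filter]
  have hM₀H : M₀ ∈ H := hmemH.2 ⟨hM₀, hrefl M₀ hM₀⟩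
  have hnear : ∀ M ∈ H, ∀ M' ∈ H, (M \ M').card < R := fun M hM M' hM' =>
    htrans M (hHsub hM) M₀ hM₀ M' (hHsub hM') (hsymm M₀ hM₀ M (hHsub hM) (hmemH.1 hM).2) (hmemH.1 hM').2
  have hHcard : H.card ≤ k := (Finset.card_le_card hHsub).trans hk
  -- STEP 3: the core
  obtain ⟨Cc, hCdef⟩ : ∃ Cc : Finset ((Fin 3 → Fin (qOf m)) × (Fin 3 → Fin (qOf m))),
      Cc = M₀ \ H.biUnion fun M' => M₀ \ M' := ⟨_, rfl⟩
  have hCM : ∀ M ∈ H, Cc ⊆ M := fun M hM e he => by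
    rw [hCdef, Finset.mem_sdiff, Finset.mem_biUnion] at he
    by_contra heM
    exact he.2 ⟨M, hM, Finset.mem_sdiff.2 ⟨he.1, heM⟩⟩
  have hCM₀ : Cc ⊆ M₀ := hCM M₀ hM₀H
  have hMC : ∀ M ∈ H, (M \ Cc).card ≤ k * R := fun M hM => by
    have hsub : M \ Cc ⊆ H.biUnion fun M' => M \ M' := fun e he => by
      have he' : e ∈ M ∧ e ∉ Cc := Finset.mem_sdiff.1 he
      rw [Finset.mem_biUnion]
      by_cases he₀ : e ∈ M₀
      · have hex : ∃ M' ∈ H, e ∈ M₀ \ M' := by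
          by_contra hne
          exact he'.2 (by rw [hCdef, Finset.mem_sdiff, Finset.mem_biUnion]; exact ⟨he₀, hne⟩)
        obtain ⟨M', hM', heM'⟩ := hex
        exact ⟨M', hM', Finset.mem_sdiff.2 ⟨he'.1, (Finset.mem_sdiff.1 heM').2⟩⟩
      · exact ⟨M₀, hM₀H, Finset.mem_sdiff.2 ⟨he'.1, he₀⟩⟩
    calc (M \ Cc).card ≤ (H.biUnion fun M' => M \ M').card := Finset.card_le_card hsub
      _ ≤ ∑ M' ∈ H, (M \ M').card := Finset.card_biUnion_le
      _ ≤ ∑ _M' ∈ H, R := Finset.sum_le_sum fun M' hM' => (hnear M hM M' hM').le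
      _ = H.card * R := by rw [Finset.sum_const, smul_eq_mul]
      _ ≤ k * R := Nat.mul_le_mul_right _ hHcard
  obtain ⟨F, hFdef⟩ : ∃ F : Finset ((Fin 3 → Fin (qOf m)) × (Fin 3 → Fin (qOf m))),
      F = H.biUnion fun M => M \ Cc := ⟨_, rfl⟩
  have hsubF : ∀ M ∈ H, M \ Cc ⊆ F := fun M hM => by
    rw [hFdef]; exact Finset.subset_biUnion_of_mem (fun M => M \ Cc) hM
  have hFcard : F.card ≤ k * (k * R) := by
    rw [hFdef]; exact (card_biUnion_sdiff_le H Cc hMC).trans (Nat.mul_le_mul_right _ hHcard)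
  obtain ⟨T, hTdef⟩ : ∃ T : Finset (Fin 3 → Fin (qOf m)),
      T = F.biUnion fun e => ({e.1, e.2} : Finset (Fin 3 → Fin (qOf m))) := ⟨_, rfl⟩
  have hTcard : T.card ≤ 2 * (k * (k * R)) := by
    rw [hTdef]; exact (card_endpoints_le F).trans (Nat.mul_le_mul_left _ hFcard)
  obtain ⟨h, hhdef⟩ : ∃ h : MvPolynomial (Fin 3 → Fin (qOf m)) ℂ,
      h = ∑ M ∈ H, C (α M) * dprod (M \ Cc) := ⟨_, rfl⟩
  have hfac : ∑ M ∈ H, C (α M) * dprod M = dprod Cc * h := by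
    rw [hhdef, Finset.mul_sum]
    refine Finset.sum_congr rfl fun M hM => ?_
    rw [dprod, dprod, dprod, ← Finset.prod_sdiff (hCM M hM)]
    ring
  have hh0 : h ≠ 0 := fun e => hfH' (by rw [hfac, e, mul_zero])
  have hvars : h.vars ⊆ T := by
    rw [hhdef, hTdef]
    refine (vars_sum_subset H fun M => C (α M) * dprod (M \ Cc)).trans
      (Finset.biUnion_subset.2 fun M hM => ?_)
    exact vars_C_mul_dprod_subset (α M) (hsubF M hM)
  -- STEP 4: the foreign gates and their kill edges
  obtain ⟨𝓕, h𝓕def⟩ : ∃ 𝓕 : Finset (Finset ((Fin 3 → Fin (qOf m)) × (Fin 3 → Fin (qOf m)))),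
      𝓕 = 𝓜.filter fun M => ¬(M₀ \ M).card < R := ⟨_, rfl⟩
  have hmem𝓕 : ∀ {M}, M ∈ 𝓕 ↔ M ∈ 𝓜 ∧ ¬(M₀ \ M).card < R := fun {M} => by rw [h𝓕def, Finset.mem_filter]
  have h𝓕card : 𝓕.card + 1 ≤ k := by
    have h1 : H.card + 𝓕.card = 𝓜.card := by
      rw [hHdef, h𝓕def]; exact Finset.card_filter_add_card_filter_not _
    have h2 : 0 < H.card := Finset.card_pos.2 ⟨M₀, hM₀H⟩
    omega
  have hfar : ∀ M' ∈ 𝓕, 4 * k ^ 2 * R ≤ (M' \ M₀).card := fun M' hM' => by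
    obtain ⟨hM'𝓜, hnot⟩ := hmem𝓕.1 hM'
    rw [Finset.card_sdiff_comm ((hn M' hM'𝓜).trans (hn M₀ hM₀).symm)]
    exact (hgap M₀ hM₀ M' hM'𝓜).resolve_left hnot
  have hkR : k ≤ k * (k * R) := Nat.le_mul_of_pos_right k (mul_pos hk0 hR0)
  have hkR' : 4 * k ^ 2 * R = 4 * (k * (k * R)) := by ring
  obtain ⟨S, hScard, hSN, hNS, hSX, hSdis⟩ := exists_disjoint_selection 𝓕 (fun M' => M' \ M₀)
    (fun M' hM' e he e' he' hne =>
      hd M' (hmem𝓕.1 hM').1 e (Finset.mem_sdiff.1 he).1 e' (Finset.mem_sdiff.1 he').1 hne)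
    T (fun M' hM' => by
      show T.card + 2 * 𝓕.card < (M' \ M₀).card + 2
      have := hfar M' hM'
      omega)
  -- the merge list
  obtain ⟨L, hLdef⟩ : ∃ L : List ((Fin 3 → Fin (qOf m)) × (Fin 3 → Fin (qOf m))), L = S.toList := ⟨_, rfl⟩
  have hmemL : ∀ {p}, p ∈ L ↔ p ∈ S := fun {p} => by rw [hLdef, Finset.mem_toList]
  have hN : L.Nodup := by rw [hLdef]; exact Finset.nodup_toList S
  have hLlen : L.length ≤ k := by rw [hLdef, Finset.length_toList]; omega
  have hV : ∀ p ∈ L, ∀ p' ∈ L, p ≠ p' → p.1 ≠ p'.1 ∧ p.1 ≠ p'.2 ∧ p.2 ≠ p'.1 ∧ p.2 ≠ p'.2 :=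
    fun p hp p' hp' hne => hSdis p (hmemL.1 hp) p' (hmemL.1 hp') hne
  have hSel : ∀ p ∈ L, ∃ M' ∈ 𝓜, p ∈ M' ∧ p ∉ M₀ := fun p hp => by
    obtain ⟨M', hM', hpM'⟩ := hSN p (hmemL.1 hp)
    have hpM'' : p ∈ M' \ M₀ := hpM'
    exact ⟨M', (hmem𝓕.1 hM').1, Finset.mem_sdiff.1 hpM''⟩
  have hl : ∀ p ∈ L, p.1 ≠ p.2 := fun p hp => by
    obtain ⟨M', hM', hpM', -⟩ := hSel p hp
    exact loopless_of_oriented (ho M' hM') p hpM'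
  -- numerics II
  have h3 : 3 ^ L.length ≤ 3 ^ k := Nat.pow_le_pow_right (by norm_num) hLlen
  have hbig : 2 + 2 * 3 ^ k ≤ (2 + 2 * 3 ^ k) * (2 * k ^ 2 * (4 * k ^ 2) ^ (k ^ 2)) :=
    Nat.le_mul_of_pos_right _ hP1
  have hmL : 2 * 3 ^ L.length < m * m := by omega
  have hKK : k * (k * R) ≤ k ^ 2 * (4 * k ^ 2) ^ (k ^ 2) :=
    calc k * (k * R) ≤ k * (k * (4 * k ^ 2) ^ (k ^ 2)) :=
          Nat.mul_le_mul_left _ (Nat.mul_le_mul_left _ hRle)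
      _ = k ^ 2 * (4 * k ^ 2) ^ (k ^ 2) := by ring
  have hK2 : 2 * k ^ 2 * (4 * k ^ 2) ^ (k ^ 2) = 2 * (k ^ 2 * (4 * k ^ 2) ^ (k ^ 2)) := by ring
  have hTP : T.card - 1 ≤ 2 * k ^ 2 * (4 * k ^ 2) ^ (k ^ 2) := by omega
  have hmT : 2 * 3 ^ L.length * (T.card - 1) < m * m :=
    lt_of_le_of_lt (Nat.mul_le_mul (by omega) hTP) hm
  -- STEP 5: merge along `L`
  have hφf : bind₁ (fun c => wordPoly m (wordL m L c)) (∑ M ∈ 𝓜, C (α M) * dprod M) = 0 :=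
    bind₁_wordL_eq_zero_of_kiPer L h0
  have hkill : ∀ M' ∈ 𝓕, bind₁ (fun c => wordPoly m (wordL m L c)) (C (α M') * dprod M') = 0 :=
    fun M' hM' => by
      obtain ⟨p, hpS, hpM'⟩ := hNS M' hM'
      have hpM'' : p ∈ M' \ M₀ := hpM'
      rw [map_mul, bind₁_wordL_dprod_eq_zero (hmemL.2 hpS) (Finset.mem_sdiff.1 hpM'').1, mul_zero]
  have hsplit : ∑ M ∈ H, C (α M) * dprod M + ∑ M ∈ 𝓕, C (α M) * dprod M = ∑ M ∈ 𝓜, C (α M) * dprod M := by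
    rw [hHdef, h𝓕def]; exact Finset.sum_filter_add_sum_filter_not _ _ _
  have hφH : bind₁ (fun c => wordPoly m (wordL m L c)) (∑ M ∈ H, C (α M) * dprod M) = 0 := by
    rw [← hsplit, map_add, map_sum (bind₁ fun c => wordPoly m (wordL m L c)) _ 𝓕,
      Finset.sum_eq_zero hkill, add_zero] at hφf
    exact hφf
  have hφC : bind₁ (fun c => wordPoly m (wordL m L c)) (dprod Cc) ≠ 0 := by
    refine bind₁_wordL_dprod_ne_zero hN hV hl hmL fun e he => ⟨?_, fun p hp => ⟨?_, ?_⟩⟩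
    · exact loopless_of_oriented (ho M₀ hM₀) e (hCM₀ he)
    · obtain ⟨_, -, -, hpM₀⟩ := hSel p hp
      exact fun hep => hpM₀ (by rw [← hep]; exact hCM₀ he)
    · obtain ⟨M', hM', hpM', -⟩ := hSel p hp
      intro hep
      have h1 : (p.1, p.2) ∈ M' := hpM'
      exact not_mem_swap_of_oriented (ho M' hM') (ho M₀ hM₀) h1 (by rw [← hep]; exact hCM₀ he)
  have hφh : bind₁ (fun c => wordPoly m (wordL m L c)) h = 0 := by
    rw [hfac, map_mul] at hφH
    exact (mul_eq_zero.1 hφH).resolve_left hφC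
  -- STEP 6: the patched support rung
  have hT : ∀ c ∈ T, ∀ p ∈ L, c ≠ p.2 := fun c hc p hp hcp =>
    (hSX p (hmemL.1 hp)).2 (by rw [← hcp]; exact hc)
  exact bind₁_wordL_ne_zero hN hV T hT hmT hh0 hvars hφh

/-! ## 3. The theorem for every fan-in -/

/-- ★ **MATCHING SUMS**: for every fan-in `k`, once `(2 + 2·3^k)(2k²(4k²)^{k²}) < m²`, the planted KI map
`G_m` hits every nonzero sum of `≤ k` products `Δ_M` of ORIENTED MATCHINGS `M`. [this file] -/
theorem kiPer_hits_matchingSums {k : ℕ}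
    (hm : (2 + 2 * 3 ^ k) * (2 * k ^ 2 * (4 * k ^ 2) ^ (k ^ 2)) < m * m)
    (𝓜 : Finset (Finset ((Fin 3 → Fin (qOf m)) × (Fin 3 → Fin (qOf m))))) (hk : 𝓜.card ≤ k)
    (ho : ∀ M ∈ 𝓜, ∀ e ∈ M, toLex e.1 < toLex e.2)
    (hd : ∀ M ∈ 𝓜, ∀ e ∈ M, ∀ e' ∈ M, e ≠ e' → e.1 ≠ e'.1 ∧ e.1 ≠ e'.2 ∧ e.2 ≠ e'.1 ∧ e.2 ≠ e'.2)
    (α : Finset ((Fin 3 → Fin (qOf m)) × (Fin 3 → Fin (qOf m))) → ℂ) (hf : ∑ M ∈ 𝓜, C (α M) * dprod M ≠ 0) :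
    bind₁ (kiPer m) (∑ M ∈ 𝓜, C (α M) * dprod M) ≠ 0 := by
  intro h0
  have hm0 : 0 < m := Nat.pos_of_ne_zero fun hm' => by rw [hm'] at hm; omega
  rw [← Finset.sum_fiberwise_of_maps_to (t := 𝓜.image Finset.card) (g := Finset.card)
    (fun M hM => Finset.mem_image_of_mem _ hM) (fun M => C (α M) * dprod M)] at hf
  obtain ⟨n, -, hn⟩ := Finset.exists_ne_zero_of_sum_ne_zero hf
  refine kiPer_hits_matchingSums_eqCard (n := n) hm (𝓜.filter fun M => M.card = n)
    ((Finset.card_le_card (Finset.filter_subset _ _)).trans hk) (fun M hM => (Finset.mem_filter.1 hM).2)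
    (fun M hM => ho M (Finset.mem_filter.1 hM).1) (fun M hM => hd M (Finset.mem_filter.1 hM).1) α hn ?_
  rw [← homogeneousComponent_bind₁_sum hm0 𝓜 α n, h0, map_zero]

/-- ★ (eventually form): for every fan-in `k` there is `m₀` beyond which `G_m` hits all such sums. [this file] -/
theorem kiPer_hits_matchingSums_eventually (k : ℕ) : ∃ m₀ : ℕ, ∀ m : ℕ, m₀ ≤ m →
    ∀ (𝓜 : Finset (Finset ((Fin 3 → Fin (qOf m)) × (Fin 3 → Fin (qOf m)))))
      (α : Finset ((Fin 3 → Fin (qOf m)) × (Fin 3 → Fin (qOf m))) → ℂ), 𝓜.card ≤ k →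
      (∀ M ∈ 𝓜, ∀ e ∈ M, toLex e.1 < toLex e.2) →
      (∀ M ∈ 𝓜, ∀ e ∈ M, ∀ e' ∈ M, e ≠ e' → e.1 ≠ e'.1 ∧ e.1 ≠ e'.2 ∧ e.2 ≠ e'.1 ∧ e.2 ≠ e'.2) →
      ∑ M ∈ 𝓜, C (α M) * dprod M ≠ 0 → bind₁ (kiPer m) (∑ M ∈ 𝓜, C (α M) * dprod M) ≠ 0 := by
  exact ⟨(2 + 2 * 3 ^ k) * (2 * k ^ 2 * (4 * k ^ 2) ^ (k ^ 2)) + 1, fun m hm 𝓜 α hk ho hd hf =>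
    kiPer_hits_matchingSums (by have := Nat.le_mul_self m; omega) 𝓜 hk ho hd α hf⟩

end Summit.ValiantsHypothesis.ValiantsHypothesis.Theorems.DefinabilityGapMatchingSums
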